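import Summits.ResolutionOfSingularities.ResolutionOfSingularities.Theorems.PurelyInseparableDim4TschirnhausClean
import Summits.ResolutionOfSingularities.ResolutionOfSingularities.Theorems.PurelyInseparableDim4FreeTail
import Summits.ResolutionOfSingularities.ResolutionOfSingularities.Theorems.PurelyInseparableDim4TschirnhausIsolation
import Summits.ResolutionOfSingularities.ResolutionOfSingularities.Theorems.PurelyInseparableDim4IsolatedCleaning
import HarnessLib
import HarnessLib.Audit.Tags

/-!
# Purely inseparable four-folds — the Tschirnhaus / W-frame move ALONG A WALK, part 2: witnessed
# `Step0` chains re-frame to witnessed `Step0` chains (cell `res-dim4-pi`, K2(p) lane, brick (ii)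
# FILE E, part 2 of 2)

[OURS · counted 0 · cell `res-dim4-pi` · brick (ii) «Tschirnhaus / W-frame infrastructure», FILE E,
desk WORD #91 (a)(2), seat res-dim4-p-11 g3; consumer = p-5 g3's slice-C «(TS2) transfer lemma».]
Nothing here proves K2(p), `NoIsolatedTrap p p` or resolution of singularities in dimension ≥ 4 /
characteristic `p`.  AI kernel work, weaker than expert review.

Part 1 (`…TschirnhausClean`, `step_cleanTsch`): the clean re-framing
`T_φ s := ⟨clean (tsch f φ s.F), s.r, s.exc⟩` commutes with the point step, `step (T_φ s) = T_{φ⁺} (step_{b⁺} s)`.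
Here it is iterated along the tree's walks:

* **`exists_isWitnessedChain_cleanTsch`**: a witnessed `Step0` chain `(c, j, β)`
  (`FreeTail.IsWitnessedChain`) whose chart letters avoid the contact letter `f`, with `f` free at `c 0`
  and `(c 0).F` clean (every state of a walk after the first is clean, `clean_of_isWitnessedChain`; shift
  the chain by one if needed), and an admissible datum `φ₀` (`f ∉ φ₀.vars`, `φ₀(0) = 0`) re-frame to the
  witnessed `Step0` chain `k ↦ T_{φ k} (c k)` with data `φ (k+1) = (φ k)⁺` and translations
  `b k = update (β k) f (β k f − (φ k)′(β k))` — moved along `x_f` only;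
* **`exists_reframed_chain`** (consumer form): the re-framed walk has the same `r`, `exc`, order and shade
  at every step, is clean, keeps `x^{r} ∣ F`, and its translations agree with the original ones off `f`.
  ISOLATION is carried at every step (`isIsolated_clean_tsch_iff` = FILE C's `isIsolated_tsch_iff` +
  `IsolatedBand.isIsolated_deletePthPowers_iff`); for `ord₀ φ ≥ 2` the residual cone is carried by part 1.
  NOT claimed: invariance of `e_G` along the walk — the data `φ k` acquire linear parts, and a linear
  move through BOUNDARY letters followed by the mandatory re-cleaning can change the polar kernel of
  the residual cone when `p ∣ ord₀ F` (example `p = 3`, `F = x₁²x₂²x_f²`, `x_f ↦ x_f + x₁ + x₂`: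
  `e_G` drops from `3` to `1`).

Idea-4 I-4-7 (TS)(ii) «one frame serves the whole stretch», at the level of the tree's walk; the
segment condition «chart letter ≠ f» is the holder's K6 (letter switch) boundary.
bears_on: LADDER-RESOLUTION:D157-DOOR2 (res-dim4-pi · K2(p) · (ii) FILE E).  Supports
stmt-ResolutionOfSingularities-16155 (helper).
-/

set_option linter.dupNamespace false -- mandated namespace of this single-conjunct summit

noncomputable section

namespace Summit.ResolutionOfSingularities.ResolutionOfSingularities.Theorems.PIDim4

namespace FrameChange

open MvPolynomial Finset
open Literature.AlgebraicGeometry.Resolution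
open Literature.AlgebraicGeometry.Resolution.Hauser2010
open Literature.AlgebraicGeometry.Resolution.HauserPerlega2019
open Literature.AlgebraicGeometry.Resolution.CentreBlowup
open PointBlowup (translate)

variable {K : Type} [Field K]

variable {f : Fin 4} {φ : MvPolynomial (Fin 4) K}

/-! ## 3. Witnessed `Step0` chains re-frame to witnessed `Step0` chains -/

section Chain

variable (p : ℕ) [hp : Fact p.Prime] [CharP K p] [DecidableEq K]

omit [DecidableEq K] in
/-- **Isolation is carried by the clean re-framing**: FILE C's `isIsolated_tsch_iff` (isolation is
invariant under the polynomial automorphism `tsch`) and `IsolatedBand.isIsolated_deletePthPowers_iff`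
(cleaning is inert for `J_p⁺`). [folklore] -/
theorem isIsolated_clean_tsch_iff (hφ : f ∉ φ.vars) (h0 : constantCoeff φ = 0) (F : MvPolynomial (Fin 4) K) :
    IsIsolated p (deletePthPowers p (tsch f φ F)) ↔ IsIsolated p F :=
  (IsolatedBand.isIsolated_deletePthPowers_iff p _).trans (isIsolated_tsch_iff p hφ h0 F)

omit hp [CharP K p] [DecidableEq K] in
/-- Evaluating an `x_f`-free polynomial does not see the `f`-coordinate. [folklore] -/
theorem eval_update_of_not_mem_vars {ψ : MvPolynomial (Fin 4) K} (hψ : f ∉ ψ.vars) (β : Fin 4 → K)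
    (t : K) : MvPolynomial.eval (Function.update β f t) ψ = MvPolynomial.eval β ψ := by
  refine MvPolynomial.hom_congr_vars (f₁ := (MvPolynomial.eval (Function.update β f t)))
    (f₂ := (MvPolynomial.eval β)) (by ext c; simp) (fun i hi _ => ?_) rfl
  have hif : i ≠ f := fun h => hψ (h ▸ hi)
  rw [eval_X, eval_X, Function.update_of_ne hif]

omit hp [CharP K p] [DecidableEq K] in
/-- **The point dictionary inverted**: for `b := update β f (β f − ψ(β))` one has `b⁺ = β`, i.e.
`update b f (b f + ψ(b)) = β` (`ψ` `x_f`-free). [folklore] -/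
theorem update_update_eq_self {ψ : MvPolynomial (Fin 4) K} (hψ : f ∉ ψ.vars) (β : Fin 4 → K) :
    Function.update (Function.update β f (β f - MvPolynomial.eval β ψ)) f
        (Function.update β f (β f - MvPolynomial.eval β ψ) f +
          MvPolynomial.eval (Function.update β f (β f - MvPolynomial.eval β ψ)) ψ) = β := by
  rw [eval_update_of_not_mem_vars hψ, Function.update_self, sub_add_cancel, Function.update_idem,
    Function.update_eq_self]

omit hp [CharP K p] in
/-- A free letter stays free off its own chart: `(step q univ j b s).r f = 0` if `s.r f = 0`, `j ≠ f`.
[cite: Hauser2010, §F (transform D')] [folklore] -/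
theorem step_r_apply_eq_zero {q : ℕ} {s : State K} (hr : s.r f = 0) {j : Fin 4} (hjf : j ≠ f)
    (b : Fin 4 → K) : (step q Finset.univ j b s).r f = 0 := by
  change newMult q Finset.univ j b s f = 0
  unfold newMult
  rw [Finsupp.update_apply, if_neg hjf.symm, Finsupp.filter_apply, hr, ite_self]

omit hp [CharP K p] in
/-- … and off the boundary: `f ∉ (step q univ j b s).exc` if `f ∉ s.exc`, `j ≠ f`. [folklore] -/
theorem not_mem_step_exc {q : ℕ} {s : State K} (he : f ∉ s.exc) {j : Fin 4} (hjf : j ≠ f)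
    (b : Fin 4 → K) : f ∉ (step q Finset.univ j b s).exc := by
  change f ∉ newExc j b s
  unfold newExc
  rw [Finset.mem_insert, Finset.mem_filter]
  rintro (h | ⟨h, -⟩)
  · exact hjf h.symm
  · exact he h

omit hp [CharP K p] in
/-- The residual polynomial of a step is clean. [folklore] -/
theorem deletePthPowers_step_F (q : ℕ) (S : Finset (Fin 4)) (j : Fin 4) (b : Fin 4 → K) (s : State K) :
    deletePthPowers q (step q S j b s).F = (step q S j b s).F :=
  PointBlowup.deletePthPowers_deletePthPowers q _

omit hp [CharP K p] in
/-- Along a witnessed chain every state after a clean start is clean. [folklore] -/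
theorem clean_of_isWitnessedChain {c : ℕ → State K} {j : ℕ → Fin 4} {β : ℕ → Fin 4 → K}
    (hw : FreeTail.IsWitnessedChain p c j β) (hclean : deletePthPowers p (c 0).F = (c 0).F) (k : ℕ) :
    deletePthPowers p (c k).F = (c k).F := by
  induction k with
  | zero => exact hclean
  | succ k _ => rw [(hw k).2.2.2.2]; exact deletePthPowers_step_F p _ _ _ _

omit hp [CharP K p] in
/-- Along a witnessed chain whose chart letters avoid `f`, the letter `f` stays free. [folklore] -/
theorem free_of_isWitnessedChain {q : ℕ} {c : ℕ → State K} {j : ℕ → Fin 4} {β : ℕ → Fin 4 → K}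
    (hw : FreeTail.IsWitnessedChain q c j β) (hjf : ∀ k, j k ≠ f) (hr : (c 0).r f = 0)
    (he : f ∉ (c 0).exc) (k : ℕ) : (c k).r f = 0 ∧ f ∉ (c k).exc := by
  induction k with
  | zero => exact ⟨hr, he⟩
  | succ k ih =>
    rw [(hw k).2.2.2.2]
    exact ⟨step_r_apply_eq_zero ih.1 (hjf k) _, not_mem_step_exc ih.2 (hjf k) _⟩

omit hp [CharP K p] in
/-- A witnessed chain is a `Step0` chain. [folklore] -/
theorem step0_of_isWitnessedChain {q : ℕ} {c : ℕ → State K} {j : ℕ → Fin 4} {β : ℕ → Fin 4 → K}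
    (hw : FreeTail.IsWitnessedChain q c j β) (k : ℕ) : Step0 q (c k) (c (k + 1)) :=
  ⟨(hw k).1, j k, β k, Finset.mem_univ _, (hw k).2.1, (hw k).2.2.1, (hw k).2.2.2.1, (hw k).2.2.2.2⟩

/-- **WITNESSED CHAINS RE-FRAME TO WITNESSED CHAINS.**  Let `(c, j, β)` be a witnessed `Step0` chain
(`FreeTail.IsWitnessedChain`) whose chart letters avoid the contact letter `f`, with `(c 0).F` clean and
`f` free at `c 0` (`r_f = 0`, `f ∉ exc`), and let `φ₀` be an admissible datum (`f ∉ φ₀.vars`, `φ₀(0) = 0`).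
Then the data `φ (k+1) := (φ k)⁺`, `b k := update (β k) f (β k f − (φ k)′(β k))` (translations moved
along `x_f` only) make `k ↦ T_{φ k} (c k) = ⟨clean (tsch f (φ k) (c k).F), (c k).r, (c k).exc⟩` a
witnessed `Step0` chain with charts `j` and points `b`, every `φ k` admissible.  (Idea-4 I-4-7 (TS)(ii)
«one frame serves the whole stretch», at the level of the tree's walk.) [OURS · brick (ii) FILE E]
[cite: Hauser2010, §§F–G] [folklore] -/
theorem exists_isWitnessedChain_cleanTsch {c : ℕ → State K} {j : ℕ → Fin 4} {β : ℕ → Fin 4 → K}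
    (hw : FreeTail.IsWitnessedChain p c j β) (hclean : deletePthPowers p (c 0).F = (c 0).F)
    (hjf : ∀ k, j k ≠ f) (hr : (c 0).r f = 0) (he : f ∉ (c 0).exc)
    {φ₀ : MvPolynomial (Fin 4) K} (hφ : f ∉ φ₀.vars) (h0 : constantCoeff φ₀ = 0) :
    ∃ (φ : ℕ → MvPolynomial (Fin 4) K) (b : ℕ → Fin 4 → K),
      φ 0 = φ₀ ∧
      (∀ k, f ∉ (φ k).vars ∧ constantCoeff (φ k) = 0) ∧
      (∀ k, b k = Function.update (β k) f
        (β k f - MvPolynomial.eval (β k) (chartTransform 1 Finset.univ (j k) (φ k)))) ∧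
      (∀ k, φ (k + 1) = translate (b k) (chartTransform 1 Finset.univ (j k) (φ k)) -
        C (MvPolynomial.eval (b k) (chartTransform 1 Finset.univ (j k) (φ k)))) ∧
      FreeTail.IsWitnessedChain p
        (fun k => (⟨deletePthPowers p (tsch f (φ k) (c k).F), (c k).r, (c k).exc⟩ : State K)) j b := by
  -- the data, by recursion on `k`
  let bOf : ℕ → MvPolynomial (Fin 4) K → (Fin 4 → K) := fun k ψ =>
    Function.update (β k) f (β k f - MvPolynomial.eval (β k) (chartTransform 1 Finset.univ (j k) ψ))
  let next : ℕ → MvPolynomial (Fin 4) K → MvPolynomial (Fin 4) K := fun k ψ =>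
    translate (bOf k ψ) (chartTransform 1 Finset.univ (j k) ψ) -
      C (MvPolynomial.eval (bOf k ψ) (chartTransform 1 Finset.univ (j k) ψ))
  let φ : ℕ → MvPolynomial (Fin 4) K := fun k => Nat.rec φ₀ next k
  have hφ0 : φ 0 = φ₀ := rfl
  have hφs : ∀ k, φ (k + 1) = next k (φ k) := fun k => rfl
  -- admissibility of every `φ k`
  have hadm : ∀ k, f ∉ (φ k).vars ∧ constantCoeff (φ k) = 0 := by
    intro k
    induction k with
    | zero => exact ⟨hφ, h0⟩
    | succ k ih =>
      rw [hφs]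
      exact ⟨not_mem_vars_tschShift (not_mem_vars_chartTransform 1 _ (hjf k) ih.1) _,
        constantCoeff_tschShift _ _⟩
  -- along the original chain: `F` clean, `f` free
  have hinv : ∀ k, deletePthPowers p (c k).F = (c k).F ∧ (c k).r f = 0 ∧ f ∉ (c k).exc := fun k =>
    ⟨clean_of_isWitnessedChain p hw hclean k, free_of_isWitnessedChain hw hjf hr he k⟩
  -- `b⁺ = β`
  have hbplus : ∀ k, Function.update (bOf k (φ k)) f (bOf k (φ k) f +
      MvPolynomial.eval (bOf k (φ k)) (chartTransform 1 Finset.univ (j k) (φ k))) = β k :=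
    fun k => update_update_eq_self (not_mem_vars_chartTransform 1 _ (hjf k) (hadm k).1) (β k)
  refine ⟨φ, fun k => bOf k (φ k), hφ0, hadm, fun k => rfl, fun k => hφs k, fun k => ?_⟩
  have hq : (p : ℕ∞) ≤ ordZero (c k).F := by rw [← ordAlong_univ]; exact (hw k).1
  refine ⟨?_, ?_, ?_, ?_, ?_⟩
  · -- order `≥ p`
    change (p : ℕ∞) ≤ ordAlong Finset.univ (deletePthPowers p (tsch f (φ k) (c k).F))
    rw [ordAlong_univ, ordZero_clean_tsch p (hadm k).1 (hadm k).2 (hinv k).1]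
    exact hq
  · -- the point lies on the new exceptional hyperplane
    change bOf k (φ k) (j k) = 0
    simp only [bOf]
    rw [Function.update_of_ne (hjf k), (hw k).2.1]
  · -- equimultiple
    rw [isEquimultiplePoint_cleanTsch_iff p hq (hjf k) (hadm k).1 (hadm k).2, hbplus k]
    exact (hw k).2.2.1
  · -- non-degenerate
    rw [step_F_cleanTsch_ne_zero_iff p hq (hjf k) (hadm k).1 (hadm k).2, hbplus k]
    exact (hw k).2.2.2.1
  · -- the recursion
    change (⟨deletePthPowers p (tsch f (φ (k + 1)) (c (k + 1)).F), (c (k + 1)).r, (c (k + 1)).exc⟩ : State K) = _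
    rw [step_cleanTsch p hq (hinv k).1 (hjf k) (hadm k).1 (hadm k).2 (hinv k).2.1 (hinv k).2.2, hbplus k,
      hφs k, ← (hw k).2.2.2.2]

/-- **THE RE-FRAMED WALK CARRIES THE LETTERS** (consumer form of `exists_isWitnessedChain_cleanTsch`):
under the same hypotheses there is a witnessed `Step0` chain `c̃` with the SAME multiplicities and
boundary components as `c`, the same order and shade at every step, isolation and `x^{r} ∣ F` carried, translations
equal to the original ones off the contact letter `f`, and `c̃ k = ⟨clean (tsch f (φ k) (c k).F), (c k).r,
(c k).exc⟩` for admissible data `φ k` with `φ 0 = φ₀`. [OURS · brick (ii) FILE E] [folklore] -/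
theorem exists_reframed_chain {c : ℕ → State K} {j : ℕ → Fin 4} {β : ℕ → Fin 4 → K}
    (hw : FreeTail.IsWitnessedChain p c j β) (hclean : deletePthPowers p (c 0).F = (c 0).F)
    (hjf : ∀ k, j k ≠ f) (hr : (c 0).r f = 0) (he : f ∉ (c 0).exc)
    {φ₀ : MvPolynomial (Fin 4) K} (hφ : f ∉ φ₀.vars) (h0 : constantCoeff φ₀ = 0) :
    ∃ (φ : ℕ → MvPolynomial (Fin 4) K) (b : ℕ → Fin 4 → K) (c' : ℕ → State K),
      φ 0 = φ₀ ∧ (∀ k, f ∉ (φ k).vars ∧ constantCoeff (φ k) = 0) ∧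
      (∀ k, c' k = ⟨deletePthPowers p (tsch f (φ k) (c k).F), (c k).r, (c k).exc⟩) ∧
      FreeTail.IsWitnessedChain p c' j b ∧
      (∀ k, Step0 p (c' k) (c' (k + 1))) ∧
      (∀ k i, i ≠ f → b k i = β k i) ∧
      (∀ k, (c' k).r = (c k).r ∧ (c' k).exc = (c k).exc ∧ ordZero (c' k).F = ordZero (c k).F ∧
        (c' k).shade = (c k).shade ∧ deletePthPowers p (c' k).F = (c' k).F ∧
        (IsIsolated p (c' k).F ↔ IsIsolated p (c k).F) ∧
        ((∀ e ∈ (c k).F.support, (c k).r ≤ e) → ∀ e ∈ (c' k).F.support, (c' k).r ≤ e)) := by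
  obtain ⟨φ, b, hφ0, hadm, hb, -, hw'⟩ := exists_isWitnessedChain_cleanTsch p hw hclean hjf hr he hφ h0
  refine ⟨φ, b, fun k => ⟨deletePthPowers p (tsch f (φ k) (c k).F), (c k).r, (c k).exc⟩, hφ0, hadm,
    fun k => rfl, hw', step0_of_isWitnessedChain hw', fun k i hi => ?_,
    fun k => ⟨rfl, rfl, ?_, ?_, ?_, ?_, ?_⟩⟩
  · rw [hb k, Function.update_of_ne hi]
  · exact ordZero_clean_tsch p (hadm k).1 (hadm k).2 (clean_of_isWitnessedChain p hw hclean k)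
  · exact shade_cleanTschState p (hadm k).1 (hadm k).2 (clean_of_isWitnessedChain p hw hclean k)
  · exact PointBlowup.deletePthPowers_deletePthPowers p _
  · exact isIsolated_clean_tsch_iff p (hadm k).1 (hadm k).2 _
  · intro hrk
    exact forall_le_of_mem_support_clean_tsch p (free_of_isWitnessedChain hw hjf hr he k).1 hrk

end Chain

end FrameChange

end Summit.ResolutionOfSingularities.ResolutionOfSingularities.Theorems.PIDim4

end
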